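import Summits.ABC.IUTFork.Repair.RHRound4ConstraintRequirementsC
import Literature.IUT.LogVolume.TensorPacketOrbitContent
import HarnessLib

/-!
# R-H ROUND 4, row R4-7, part C — PROOF-ONLY COMPANION: the displayed hypotheses of §V6 R-V6-1 DISCHARGED
# (orbit transitivity and orbit-module rigidity of the log-packet lattice are THEOREMS of the tree's `p`-adic lattice algebra)

abc-iut cell, rung LADDER-ABC:A2.RESCUE.H; seat abc-iut-L5-t8 (GEN 12, 2026-08-27; requirements owner of `Repair/RHRound4ConstraintRequirementsC.lean`
★ p540469 / v2 ★ p544620). Census O-15 (sheet V6 `ROUND4/R4-7-V6-abc-iut-rh3-gen-5.md` 776c7c62401f99ce, item R-V6-1) stood at «KILLED-AS-TYPED in both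
readings, each MODULO A DISPLAYED HYPOTHESIS that nothing proves» — v1 (set-valued `V6_R1_finerStableFiltration`) modulo `V6_R1_orbitTransitivity`, v2
(subgroup-valued `V6_R1_finerStableSubgroupFiltration`) modulo the weaker `V6_R1_orbitModuleRigidity` (face lane ★ p542823
`Round4ConstraintFacesEven.no_finerSubgroupFiltration_of_orbitModuleRigidity`). THIS FILE PROVES BOTH HYPOTHESES for every non-empty packet index set `I`,
BY NAME from the tree's lattice algebra (campaign-S LogVolume library; Weil, *Basic Number Theory* Ch. II §2 Th. 1–2):

* `Literature.IUT.LogVolume.exists_basisLattice_eq_logPacket` — `L = log_p(R_I^×)` IS the lattice `L_B` of a `ℚ_p`-basis `B` of `V = ⊗ k_i`;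
* `Literature.IUT.LogVolume.PadicModule.primitive_iff_not_mem_p_smul` — `x ∈ L_B ∖ p·L_B` iff some `B`-coordinate of `x` is a unit;
* `Literature.IUT.LogVolume.PadicModule.exists_latticeAut_map_eq` — `Aut_{ℚ_p}(V : L_B)` is TRANSITIVE on such vectors;
* `Literature.IUT.LogVolume.indTwo_eq_latticeAut` / `isLogPacketAut_of_mem` — that group is (Ind2), whose members are exactly the log-packet
  automorphisms `IsLogPacketAut` of [IUTchIV] Prop. 1.2;
* `Literature.IUT.LogVolume.ppow_smul_set_eq` — the packet power `ppow p k n` dilates regions as the scalar `p^n ∈ ℚ_p`.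

Results (namespace `Summit.ABC.IUTFork.Repair.RH.Round4ConstraintRequirements`, next to the hypotheses they discharge):
`V6_R1_orbitTransitivity_holds` · `exists_isLogPacketAut_map_eq_of_level` (the sheet's full sentence «GL(L) acts transitively on EACH level
p^nL ∖ p^{n+1}L», `n ∈ ℤ`) · `V6_R1_orbitModuleRigidity_holds` · and the two kills now UNCONDITIONAL for `e ≥ 2` and an indeterminacy predicate
`Ind` holding of every log-packet automorphism (print's `G ⊇` (Ind2)): `not_finerStableFiltration` (v1) · `not_finerStableSubgroupFiltration` (v2).
So census O-15's R-V6-1 is KILLED-BY-CONSISTENCY IN THE KERNEL with no residual hypothesis about the packet lattice (the residual `[Nonempty I]` is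
print's `|I| ≥ 1`; for `I = ∅` the lattice is `ℤ·1 ⊂ ℚ_p` and transitivity genuinely fails, e.g. `1 ↦ 1 + p`).
HONEST FRAMING: a consistency verdict on OUR typed requirement in OUR packet currency — a hypothetical finer (1/e)ℤ-indexed filtration refining
`{p^n·L}` and stable under all of (Ind2) does not exist; KILLED-as-typed ≠ refuted in print; nothing here reads, endorses or disputes [IUTchI–IV];
no side on [IUTchIII] Cor 3.12 / Rmk 3.9.3 / [IUTchIV] Thm 1.10 / Prop 1.2 or on any author (D-0045); nothing here asserts that abc is proved or refuted.
PROOF-ONLY file: 0 `def`, 0 new `Prop` facts, no `instance` / `notation` / `macro`; FROZEN FACT-LIST f75a60bac22efdb6 untouched.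
[cite: WeilBNT1967, Ch. II §2, Th. 1–2] [cite: DupuyHilado2025, §4.9] [claim: Mochizuki2012, status: disputed] for every IUT locution.
-/

noncomputable section

namespace Summit.ABC.IUTFork.Repair.RH.Round4ConstraintRequirements

open Literature.IUT.LogVolume
open scoped Pointwise

section V6PacketDischarge

variable (p : ℕ) [Fact p.Prime]
variable {I : Type} [Fintype I] [DecidableEq I] [Nonempty I]
variable (k : I → Type) [∀ i, NontriviallyNormedField (k i)] [∀ i, NormedAlgebra ℚ_[p] (k i)]
variable [∀ i, IsUltrametricDist (k i)] [∀ i, ProperSpace (k i)]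

omit [Fintype I] [DecidableEq I] [Nonempty I] [∀ i, IsUltrametricDist (k i)] [∀ i, ProperSpace (k i)] in
/-- `p·L = p • L`: the packet power `ppow p k 1 ∈ V` dilates the lattice as the scalar `p ∈ ℚ_p` (`ppow_smul_set_eq`).
[cite: DupuyHilado2025, §4 (intro)] -/
theorem ppow_one_smul_logPacket :
    ppow p k 1 • (logPacket p k : Set (PacketAlgebra p k)) = (p : ℚ_[p]) • (logPacket p k : Set (PacketAlgebra p k)) := by
  rw [ppow_smul_set_eq, zpow_one]

omit [Fintype I] [DecidableEq I] [Nonempty I] [∀ i, IsUltrametricDist (k i)] [∀ i, ProperSpace (k i)] in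
/-- The log-packet automorphisms of [IUTchIV] Prop. 1.2 (`IsLogPacketAut`: `φ(L) = L`) are EXACTLY the members of (Ind2) `indTwo = Aut_{ℚ_p}(V : L)`
(`isLogPacketAut_of_mem` / `mem_indTwo_of_image_eq`, `TensorPacketShell`). [cite: DupuyHilado2025, §4.9] -/
theorem isLogPacketAut_iff_mem_indTwo (φ : PacketAlgebra p k ≃ₗ[ℚ_[p]] PacketAlgebra p k) :
    IsLogPacketAut p k φ ↔ φ ∈ indTwo p k :=
  ⟨fun h => mem_indTwo_of_image_eq p k h, fun h => isLogPacketAut_of_mem p k h⟩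

/-- **ORBIT TRANSITIVITY HOLDS** (discharges the displayed hypothesis `V6_R1_orbitTransitivity` of ★ p544620): any two vectors of `L ∖ p·L`
(`L = log_p(R_I^×)`) are exchanged by a log-packet automorphism. Proof BY NAME: `L` is the lattice of a basis `B` of `V`
(`exists_basisLattice_eq_logPacket`); `x ∉ p·L` means some `B`-coordinate of `x` is a unit (`primitive_iff_not_mem_p_smul`); the lattice
automorphism group is transitive on such vectors (`exists_latticeAut_map_eq`, Weil Ch. II §2 Th. 1 in automorphism form); and that group is
(Ind2) (`indTwo_eq_latticeAut`), i.e. log-packet automorphisms (`isLogPacketAut_of_mem`). [cite: WeilBNT1967, Ch. II §2, Th. 1] -/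
theorem V6_R1_orbitTransitivity_holds : V6_R1_orbitTransitivity p k := by
  intro x y hxL hxp hyL hyp
  obtain ⟨κ, _, B, hB⟩ := exists_basisLattice_eq_logPacket p k
  have hxB : x ∈ PadicModule.basisLattice p B := by rw [hB]; exact hxL
  have hyB : y ∈ PadicModule.basisLattice p B := by rw [hB]; exact hyL
  rw [ppow_one_smul_logPacket, ← hB] at hxp hyp
  obtain ⟨i, hi⟩ := (PadicModule.primitive_iff_not_mem_p_smul p B hxB).mpr hxp
  obtain ⟨j, hj⟩ := (PadicModule.primitive_iff_not_mem_p_smul p B hyB).mpr hyp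
  obtain ⟨φ, hφ, hφxy⟩ := PadicModule.exists_latticeAut_map_eq p B hxB hyB hi hj
  rw [← indTwo_eq_latticeAut p k hB] at hφ
  exact ⟨φ, isLogPacketAut_of_mem p k hφ, hφxy⟩

omit [Fintype I] [DecidableEq I] [Nonempty I] [∀ i, IsUltrametricDist (k i)] [∀ i, ProperSpace (k i)] in
/-- A vector of `p^n·L ∖ p^{n+1}·L` is `p^n · x₀` with `x₀ ∈ L ∖ p·L` (`ppow_add`: `p^n·(p·x₁) = p^{n+1}·x₁`). Bookkeeping for the level form below.
[cite: WeilBNT1967, Ch. II §2, Th. 2] -/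
theorem exists_eq_ppow_mul_of_level (n : ℤ) {x : PacketAlgebra p k}
    (hx : x ∈ ppow p k n • (logPacket p k : Set (PacketAlgebra p k)))
    (hx' : x ∉ ppow p k (n + 1) • (logPacket p k : Set (PacketAlgebra p k))) :
    ∃ x₀ : PacketAlgebra p k, x₀ ∈ logPacket p k ∧ x₀ ∉ ppow p k 1 • (logPacket p k : Set (PacketAlgebra p k)) ∧
      x = ppow p k n * x₀ := by
  obtain ⟨x₀, hx₀, rfl⟩ := Set.mem_smul_set.mp hx
  refine ⟨x₀, hx₀, fun h => hx' ?_, rfl⟩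
  obtain ⟨x₁, hx₁, rfl⟩ := Set.mem_smul_set.mp h
  refine Set.mem_smul_set.mpr ⟨x₁, hx₁, ?_⟩
  rw [smul_eq_mul, smul_eq_mul, smul_eq_mul, ← mul_assoc, ← ppow_add]

/-- **TRANSITIVITY ON EVERY LEVEL** — the sheet's full sentence «GL(L) acts transitively on each level `p^nL ∖ p^{n+1}L`» (R-V6-1, parenthesis of
the typed obstruction), `n ∈ ℤ`: scale down to the top level (`exists_eq_ppow_mul_of_level`), move there (`V6_R1_orbitTransitivity_holds`), scale
back by `ℚ_p`-linearity (`ppow_mul_eq_smul`). [cite: WeilBNT1967, Ch. II §2, Th. 1–2] -/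
theorem exists_isLogPacketAut_map_eq_of_level (n : ℤ) {x y : PacketAlgebra p k}
    (hx : x ∈ ppow p k n • (logPacket p k : Set (PacketAlgebra p k)))
    (hx' : x ∉ ppow p k (n + 1) • (logPacket p k : Set (PacketAlgebra p k)))
    (hy : y ∈ ppow p k n • (logPacket p k : Set (PacketAlgebra p k)))
    (hy' : y ∉ ppow p k (n + 1) • (logPacket p k : Set (PacketAlgebra p k))) :
    ∃ φ : PacketAlgebra p k ≃ₗ[ℚ_[p]] PacketAlgebra p k, IsLogPacketAut p k φ ∧ φ x = y := by
  obtain ⟨x₀, hx₀, hx₀', rfl⟩ := exists_eq_ppow_mul_of_level p k n hx hx'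
  obtain ⟨y₀, hy₀, hy₀', rfl⟩ := exists_eq_ppow_mul_of_level p k n hy hy'
  obtain ⟨φ, hφ, hφxy⟩ := V6_R1_orbitTransitivity_holds p k x₀ y₀ hx₀ hx₀' hy₀ hy₀'
  refine ⟨φ, hφ, ?_⟩
  rw [ppow_mul_eq_smul, ppow_mul_eq_smul, LinearEquiv.map_smul, hφxy]

/-- **ORBIT-MODULE RIGIDITY HOLDS** (discharges the displayed hypothesis `V6_R1_orbitModuleRigidity` of ★ p540469, the one the face lane's kill
★ p542823 assumes): an additive subgroup of `V` stable under every log-packet automorphism and meeting `L ∖ p·L` contains `L`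
(`orbitModuleRigidity_of_orbitTransitivity` ★ p544620 + `V6_R1_orbitTransitivity_holds`). [cite: WeilBNT1967, Ch. II §2, Th. 1] -/
theorem V6_R1_orbitModuleRigidity_holds : V6_R1_orbitModuleRigidity p k :=
  orbitModuleRigidity_of_orbitTransitivity p k (V6_R1_orbitTransitivity_holds p k)

/-- **R-V6-1, v1 (SET-VALUED) READING — KILLED UNCONDITIONALLY** (census O-15): for `e ≥ 2` and an indeterminacy predicate `Ind` holding of every
log-packet automorphism (print's `G ⊇` (Ind2)), NO strictly decreasing `G`-stable set filtration with `Fil(n·e) = p^n·L` exists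
(`not_finerStableFiltration_of_orbitTransitivity` ★ p544620 with its hypothesis discharged). A consistency verdict on OUR typed requirement;
KILLED-as-typed ≠ refuted in print. [claim: Mochizuki2012, status: disputed] -/
theorem not_finerStableFiltration {e : ℕ} (he : 2 ≤ e)
    {Ind : (PacketAlgebra p k ≃ₗ[ℚ_[p]] PacketAlgebra p k) → Prop} (hInd : ∀ φ, IsLogPacketAut p k φ → Ind φ) :
    ¬ V6_R1_finerStableFiltration p k e Ind :=
  not_finerStableFiltration_of_orbitTransitivity p k (V6_R1_orbitTransitivity_holds p k) he hInd

/-- **R-V6-1, v2 (SUBGROUP-VALUED, the sheet's signature) READING — KILLED UNCONDITIONALLY** (census O-15): same verdict for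
`V6_R1_finerStableSubgroupFiltration` (`not_finerStableSubgroupFiltration_of_orbitTransitivity` ★ p544620, hypothesis discharged; equivalently the
face lane's `no_finerSubgroupFiltration_of_orbitModuleRigidity` ★ p542823 fed with `V6_R1_orbitModuleRigidity_holds`). KILLED-as-typed ≠ refuted in
print. [claim: Mochizuki2012, status: disputed] -/
theorem not_finerStableSubgroupFiltration {e : ℕ} (he : 2 ≤ e)
    {Ind : (PacketAlgebra p k ≃ₗ[ℚ_[p]] PacketAlgebra p k) → Prop} (hInd : ∀ φ, IsLogPacketAut p k φ → Ind φ) :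
    ¬ V6_R1_finerStableSubgroupFiltration p k e Ind :=
  not_finerStableSubgroupFiltration_of_orbitTransitivity p k (V6_R1_orbitTransitivity_holds p k) he hInd

end V6PacketDischarge

end Summit.ABC.IUTFork.Repair.RH.Round4ConstraintRequirements

end
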